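import Literature.NumberTheory.Automorphic.TotallyRealModularityLargeImage
import HarnessLib

/-!
# Freitas–Le Hung–Siksek 2015, Theorems 3 and 4: the mod-`3`/`5`/`7` modularity criteria
# for elliptic curves over totally real fields

Topic `Literature/NumberTheory/Automorphic` (reciprocity for `GL₂` over totally real fields;
companion of `TotallyRealModularity.lean` and `TotallyRealModularityLargeImage.lean`, whose
carriers `IsAutomorphicOfWeightZero` and `ModPImageAbsIrreducibleOverCyclotomic` we use verbatim).

`TotallyRealModularityLargeImage.lean` renders the printed proof of FLS Thm. 5 from two
HYPOTHESES (A) = "Thms. 3–4" and (B) = "Prop. 3.1 + Faltings" (`FLS2015_theorem5_of_largeImage`)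
and records that neither is a named fact of the tree. This file vendors (A) — the two printed
modularity criteria — as ONE named fact `FLS2015_theorems3_4` (D-0014; users take
`(h : FLS2015_theorems3_4)`), exactly in the shape of hypothesis (A), and proves the bookkeeping
around it: the contrapositive used downstream (a non-modular `E` has `ρ̄_{E,p}(G_{K(ζ_p)})`
absolutely reducible for `p = 3, 5, 7` simultaneously), the two weaker modularity notions of the
tree, and FLS Thm. 5 from the fact plus hypothesis (B).

CANONICAL HOME (2026-08-17). Three parallel grounder seats vendored this statement within minutes
of each other on 2026-08-16; after the deduplication of `TotallyRealNonModularImages.lean`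
(which now IMPORTS this file and keeps only theorems) this module is the unique declaration of
`FLS2015_theorems3_4` in the library. Do not re-declare it elsewhere; import this file.

Grounds the route crux `Summit.Langlands.Langlands.Theses.SqrtFiveQuarticCovers.ReductionToRefinedLocus`
(ledger stmt-Langlands-17834; its chain starts "FLS Thms 3–4 ⇒ each `ρ̄_{E,p}(G_{K(ζ_p)})`
absolutely reducible") — the item is this fact ∘ (FLS Prop. 3.1/Lemma 3.2, Rubin at `p = 3`,
Kalyanswamy 2018 + the FLS `e7` refinement at `p = 7`, and the `𝔽₅` subgroup census), none of
which is supplied here.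

## What the source prints (quoted from the held text `paper:arxiv-1310.7088`, pp. 4–5)

* Theorem 3. "Let `p = 3` or `5`. Let `E` be an elliptic curve over a totally real field `K`.
  Suppose that `ρ̄_{E,p}(G_{K(ζ_p)})` is absolutely irreducible. Then `E` is modular."
* Theorem 4. "Let `E` be an elliptic curve over a totally real field `K`. Suppose that
  `ρ̄_{E,7}(G_{K(ζ_7)})` is absolutely irreducible. Then `E` is modular."
* "modular" (§1): there is a Hilbert cuspidal eigenform `𝔣` over `K` of parallel weight `2` and
  rational Hecke eigenvalues with `L(E, s) = L(𝔣, s)` — rendered, as for every fact of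
  `TotallyRealModularity.lean`, by `IsAutomorphicOfWeightZero E` (a weight-zero cuspidal `π` of
  `GL₂(𝔸_K)` with Hecke polynomial `X² − a_w X + q_w` at every `w ∤ Δ(E)`) for an INTEGRAL
  Weierstrass model with `Δ(E) ≠ 0` (every elliptic curve over `K` has one; modularity is
  isomorphism-invariant).
* Both theorems rest on Thm. 2 (Breuil–Diamond / Kisin / Gee / Barnet-Lamb–Gee–Geraghty lifting,
  §(modlift), where the `p = 5`, `√5 ∈ K` case of the Taylor–Wiles hypothesis is treated),
  Langlands–Tunnell (§(lt)) and the `3`–`5` / `3`–`7` switches (§§(35), (37)); the statements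
  above carry NO hypothesis on `K` beyond total reality — in particular none on `√5 ∈ K` and none
  on `K ∩ ℚ(ζ₇)`.

## Deliberately NOT transcribed

The refinements of the exceptional images (FLS Prop. 3.1 (ii)–(iii), Lemma 3.2, the `e7` group;
Kalyanswamy 2018; Thorne 2016 for `p = 5`, `√5 ∉ K`) — separate facts with their own carriers
(`Box2022_theorem1_3` in `TotallyRealModularityBoxImages.lean`).

## References

* [FreitasLeHungSiksek2015] N. Freitas, B. V. Le Hung, S. Siksek, Elliptic curves over real
  quadratic fields are modular, Invent. Math. 201 (2015) 159–206 — Thms. 3, 4 (pp. 4–5 of the held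
  text `paper:arxiv-1310.7088`), Thm. 2, Prop. 3.1, §7.
-/

open scoped NumberField
open NumberField

noncomputable section

namespace Literature.NumberTheory.Automorphic

/-- **Freitas–Le Hung–Siksek (2015), Theorems 3 and 4: the mod-`p` modularity criteria,
`p ∈ {3, 5, 7}`.** "Let `p = 3` or `5`. Let `E` be an elliptic curve over a totally real field
`K`. Suppose that `ρ̄_{E,p}(G_{K(ζ_p)})` is absolutely irreducible. Then `E` is modular."
(Thm. 3) and "Let `E` be an elliptic curve over a totally real field `K`. Suppose that
`ρ̄_{E,7}(G_{K(ζ_7)})` is absolutely irreducible. Then `E` is modular." (Thm. 4). Rendered on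
the tree's carriers: for every totally real number field `K`, every integral Weierstrass model
`E / 𝓞 K` with `Δ(E) ≠ 0` and every `p ∈ {3, 5, 7}`, if `ρ̄_{E,p}(G_{K(ζ_p)})` is absolutely
irreducible (`ModPImageAbsIrreducibleOverCyclotomic (E ⊗ K) p`: for every framing of the Galois
action on `E[p]` and every model of `K(ζ_p)`), then `IsAutomorphicOfWeightZero E`. This is
VERBATIM hypothesis (A) of `FLS2015_theorem5_of_largeImage`. A named fact (D-0014): users take
`(h : FLS2015_theorems3_4)`. Grounds
`Summit.Langlands.Langlands.Theses.SqrtFiveQuarticCovers.ReductionToRefinedLocus`.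
[cite: FreitasLeHungSiksek2015, Thm. 3 and Thm. 4] -/
def FLS2015_theorems3_4 : Prop :=
  ∀ (K : Type) [Field K] [NumberField K] [IsTotallyReal K] (E : WeierstrassCurve (𝓞 K)),
    E.Δ ≠ 0 → ∀ (p : ℕ) [Fact p.Prime], (p = 3 ∨ p = 5 ∨ p = 7) →
      ModPImageAbsIrreducibleOverCyclotomic (E.baseChange K) p → IsAutomorphicOfWeightZero E

/-- **Contrapositive (the form route SqrtFiveQuarticCovers consumes).** Under FLS Thms. 3–4, an
integral model `E / 𝓞 K` (`Δ ≠ 0`, `K` totally real) that is NOT automorphic of weight zero has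
`ρ̄_{E,p}(G_{K(ζ_p)})` absolutely reducible for each `p ∈ {3, 5, 7}` — "an elliptic curve `E`
over a totally real field `K` is modular except possibly if the images `ρ̄_{E,p}(G_{K(ζ_p)})` are
simultaneously absolutely reducible for `p = 3, 5, 7`" (source, after Thm. 4).
[cite: FreitasLeHungSiksek2015, Thm. 3 and Thm. 4] -/
theorem FLS2015_theorems3_4.not_modPImageAbsIrreducible (h : FLS2015_theorems3_4)
    (K : Type) [Field K] [NumberField K] [IsTotallyReal K] {E : WeierstrassCurve (𝓞 K)}
    (hΔ : E.Δ ≠ 0) (hE : ¬ IsAutomorphicOfWeightZero E) (p : ℕ) [Fact p.Prime]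
    (hp : p = 3 ∨ p = 5 ∨ p = 7) :
    ¬ ModPImageAbsIrreducibleOverCyclotomic (E.baseChange K) p :=
  fun himg => hE (h K E hΔ p hp himg)

/-- FLS Thms. 3–4 with the cofinite weak conclusion `IsHilbertModular E`
(via `IsHilbertModular.of_isAutomorphicOfWeightZero`).
[cite: FreitasLeHungSiksek2015, Thm. 3 and Thm. 4] -/
theorem FLS2015_theorems3_4.isHilbertModular (h : FLS2015_theorems3_4)
    (K : Type) [Field K] [NumberField K] [IsTotallyReal K] {E : WeierstrassCurve (𝓞 K)}
    (hΔ : E.Δ ≠ 0) (p : ℕ) [Fact p.Prime] (hp : p = 3 ∨ p = 5 ∨ p = 7)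
    (himg : ModPImageAbsIrreducibleOverCyclotomic (E.baseChange K) p) : IsHilbertModular E :=
  IsHilbertModular.of_isAutomorphicOfWeightZero hΔ (h K E hΔ p hp himg)

/-- FLS Thms. 3–4 with the trace-only conclusion `IsModularEllipticCurve K E` of
Caraiani–Newton (the notion the summit-side routes write out by its definition), via
`IsHilbertModular.isModularEllipticCurve`. [cite: FreitasLeHungSiksek2015, Thm. 3 and Thm. 4] -/
theorem FLS2015_theorems3_4.isModularEllipticCurve (h : FLS2015_theorems3_4)
    (K : Type) [Field K] [NumberField K] [IsTotallyReal K] {E : WeierstrassCurve (𝓞 K)}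
    (hΔ : E.Δ ≠ 0) (p : ℕ) [Fact p.Prime] (hp : p = 3 ∨ p = 5 ∨ p = 7)
    (himg : ModPImageAbsIrreducibleOverCyclotomic (E.baseChange K) p) :
    IsModularEllipticCurve K E :=
  (h.isHilbertModular K hΔ p hp himg).isModularEllipticCurve

/-- **FLS Thm. 5 from the named fact Thms. 3–4 and the printed §7 finiteness step (B).** The
hypothesis (A) of `FLS2015_theorem5_of_largeImage` is now the named fact; (B) (Prop. 3.1 ⇒ a
`K`-point on one of the 27 curves `X(u,v,w)` of genus `> 1`, then Faltings) stays a hypothesis.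
[cite: FreitasLeHungSiksek2015, §7 (proof of Thm. 5)] -/
theorem FLS2015_theorem5_of_theorems3_4 (hA : FLS2015_theorems3_4)
    (hB : ∀ (K : Type) [Field K] [NumberField K] [IsTotallyReal K], ∃ S : Finset K,
      ∀ E : WeierstrassCurve (𝓞 K), E.Δ ≠ 0 →
        (∀ (p : ℕ) [Fact p.Prime], (p = 3 ∨ p = 5 ∨ p = 7) →
          ¬ ModPImageAbsIrreducibleOverCyclotomic (E.baseChange K) p) →
        (algebraMap (𝓞 K) K E.c₄) ^ 3 / algebraMap (𝓞 K) K E.Δ ∈ S) :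
    FLS2015_theorem5 :=
  FLS2015_theorem5_of_largeImage hA hB

end Literature.NumberTheory.Automorphic

end
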